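import Mathlib.Data.Int.ModEq
import Literature.Computability.Complexity.SuccinctCircuitBitsMachine
import HarnessLib

/-!
# Succinct arithmetic circuits of polynomial depth, IV: value bounds and the two's-complement
# read-out of integers

Sequel of `SuccinctCircuitBits.lean` / `SuccinctCircuitBitsMachine.lean`. Two small services for
consumers whose quantities are INTEGERS (the linear-algebra consumer of the KV20 M1 programme:
entries of `AᵀA`, powers of the Mahajan–Vinay matrix, `q_B(B)·B^j`, a kernel vector):

* §Bounds — **`val_lt_two_pow_hdrPoly`**: every gate value is `< 2^{2^{H(|g|)} · 2^{depth g}}` (`H` the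
  header polynomial `hdrPoly`: constants have `< 2^H` bits, sums have `< 2^H` children, names do
  not lengthen), hence `< 2^{valBits g}` for the polynomial-time computable poly-bit number
  `valBits g = 2^{H(|g|)} · 2^{dpoly(|g|)}` (`valBits_fp`) — the width a consumer may feed to a
  select gate or to the two's-complement read-out.
* §TwosComplement — integers `c` with `|c| < 2^v` are carried by ANY natural `X ≡ c (mod 2^{v+1})`
  (Knuth, §4.1, two's complement notation): sums and products of representatives are
  representatives (`Int.ModEq`), the constant `c` is represented by `c mod 2^{v+1}`, whose bits are
  those of `c` (`c ≥ 0`) or the complements of the bits of `|c| − 1` (`c < 0`,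
  `testBit_twosRep_neg`); and the READ-OUT: **`neg_iff_testBit`** (`c < 0 ⟺` bit `v` of `X`),
  **`testBit_natAbs_of_nonneg`** (`c ≥ 0 ⇒` the bits of `|c|` below `v+1` are those of `X`;
  for `c < 0` apply it to `−c` and a representative of `−c`, e.g. `(2^{v+1} − 1)·X`,
  `neg_rep`), **`eq_zero_iff_mod`** (`c = 0 ⟺ X ≡ 0`, the select gate's test). So a consumer
  encoding integers in two's complement inside a `SuccCircuit` needs no comparison or subtraction
  gate: signs and magnitudes are single `bitLang` queries.

HONEST FRAMING (val-lit, KV20 M1 programme, brick (P2) layer G): generic plumbing; proves nothing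
about `kumarVolk2020_cor_1_3` by itself; `VP ≠ VNP` is NOT proved and nothing here bears on it.

## References

* P. Koiran, S. Perifel, *VPSPACE and a transfer theorem over the reals*, Comput. Complexity 18
  (2009), §3.1, Def. 1 (coefficient function: bit `i` and the sign) and §3.2, Prop. 1 (proof: the
  size of the values at depth `i` is `(nd)^{O(1)} 2^i`) [KoiranPerifel2009VPSPACE].
* D. E. Knuth, *TAOCP 2*, §4.1 (two's complement notation: "−x is represented by 2ⁿ − x";
  complement-and-increment) [KnuthTAOCP2].
-/

noncomputable section

namespace Literature.Computability.Complexity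

open _root_.Computability Polynomial CodeFP Brick Finset

namespace SuccCircuit

variable (K : SuccCircuit)

/-! ### Bounds on gate values -/

/-- A number all of whose bits from `M` on vanish is `< 2^M`. [cite: KnuthTAOCP2, §4.1] -/
private theorem lt_two_pow_of_testBit {x M : ℕ} (h : ∀ i, M ≤ i → x.testBit i = false) : x < 2 ^ M :=
  Nat.lt_pow_two_of_testBit x h

/-- A constant gate's value is `< 2^{width g}` (a private twin of `SuccinctCircuitNames.cval_lt_two_pow`,
x5 g7, kept local so that this file does not wait on that module). [cite: KoiranPerifel2009VPSPACE, §3.2, Prop. 1 (proof: "For the input gates, this is easy")] -/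
private theorem cval_lt_two_pow_width (g : List Bool) : K.cval g < 2 ^ K.width g :=
  lt_two_pow_of_testBit fun i hi => by rw [K.testBit_cval]; simp [Nat.not_lt.2 hi]

/-- **Value bound by depth**: `val g < 2^{2^{H(|g|)} · 2^{depth g}}` — a constant has `< 2^H` bits,
a sum of `< 2^H` numbers of `B` bits has `≤ B + H` bits, a product doubles, a select does not grow;
children are no longer than the parent so their `H` is no larger. [cite: KoiranPerifel2009VPSPACE, §3.2, Prop. 1 (proof: "the size of its coefficients is (nd)^{O(1)} 2^i")] -/
theorem val_lt_two_pow_hdrPoly : ∀ (n : ℕ) (g : List Bool), K.depth g ≤ n →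
    K.val g < 2 ^ (2 ^ K.hdrPoly.eval g.length * 2 ^ n) := by
  intro n
  induction n with
  | zero =>
    intro g hg
    obtain ⟨-, hA, hW⟩ := K.lt_two_pow_hdrPoly g
    have hd : K.depth g = 0 := by omega
    by_cases h1 : K.kind g = 1
    · -- a sum of depth `0` is empty
      have ha : K.arity g = 0 := by
        by_contra hne
        have := K.depth_child g 0 (by simp [gateFanIn, h1]; omega)
        omega
      rw [K.val_sum h1, ha, sum_range_zero]
      positivity
    · by_cases h2 : K.kind g = 2
      · have := K.depth_child g 0 (by simp [gateFanIn, h2]); omega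
      · by_cases h3 : K.kind g = 3
        · have := K.depth_child g 0 (by simp [gateFanIn, h3]); omega
        · rw [K.val_const h1 h2 h3, pow_zero, mul_one]
          exact (K.cval_lt_two_pow_width g).trans_le (Nat.pow_le_pow_right (by norm_num) (le_of_lt hW))
  | succ n ih =>
    intro g hg
    obtain ⟨-, hA, hW⟩ := K.lt_two_pow_hdrPoly g
    set B := 2 ^ K.hdrPoly.eval g.length with hB
    -- every in-range child is shallower and no longer, so the induction hypothesis applies with the same `B`
    have hch : ∀ k, k < gateFanIn (K.kind g) (K.arity g) → K.val (K.child g k) < 2 ^ (B * 2 ^ n) := by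
      intro k hk
      have hdk : K.depth (K.child g k) ≤ n := by have := K.depth_child g k hk; omega
      have hlen := K.length_child g k hk
      refine (ih _ hdk).trans_le (Nat.pow_le_pow_right (by norm_num) (Nat.mul_le_mul_right _ ?_))
      exact Nat.pow_le_pow_right (by norm_num) (TM2Iter.eval_mono _ hlen)
    have hBpos : 1 ≤ B := Nat.one_le_two_pow
    have hstep : B * 2 ^ n + B * 2 ^ n = B * 2 ^ (n + 1) := by rw [pow_succ]; ring
    by_cases h1 : K.kind g = 1
    · -- SUM: `< arity · 2^{B 2^n} ≤ 2^B · 2^{B 2^n} ≤ 2^{B 2^{n+1}}`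
      rw [K.val_sum h1]
      calc ∑ k ∈ range (K.arity g), K.val (K.child g k)
          < ∑ _k ∈ range (K.arity g), 2 ^ (B * 2 ^ n) + 1 := by
            refine Nat.lt_succ_of_le (sum_le_sum fun k hk => le_of_lt (hch k ?_))
            simpa [gateFanIn, h1] using mem_range.1 hk
        _ = K.arity g * 2 ^ (B * 2 ^ n) + 1 := by rw [sum_const, card_range, smul_eq_mul]
        _ ≤ 2 ^ B * 2 ^ (B * 2 ^ n) := by
            have h1' : K.arity g + 1 ≤ 2 ^ B := by
              have : K.arity g < B := hA; have := Nat.lt_two_pow_self (n := B); omega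
            have h2' : 1 ≤ 2 ^ (B * 2 ^ n) := Nat.one_le_two_pow
            nlinarith
        _ ≤ 2 ^ (B * 2 ^ (n + 1)) := by
            rw [← pow_add, ← hstep]
            exact Nat.pow_le_pow_right (by norm_num) (by nlinarith [Nat.one_le_two_pow (n := n)])
    · by_cases h2 : K.kind g = 2
      · -- PRODUCT: `< 2^{B 2^n} · 2^{B 2^n}`
        rw [K.val_mul h2, ← hstep, pow_add]
        have h0 := hch 0 (by simp [gateFanIn, h2])
        have h1' := hch 1 (by simp [gateFanIn, h2])
        exact Nat.mul_lt_mul'' h0 h1'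
      · by_cases h3 : K.kind g = 3
        · -- SELECT: one of the children
          rw [K.val_mux h3]
          have h2' := hch 2 (by simp [gateFanIn, h3])
          have h3' := hch 3 (by simp [gateFanIn, h3])
          have hmono : 2 ^ (B * 2 ^ n) ≤ 2 ^ (B * 2 ^ (n + 1)) :=
            Nat.pow_le_pow_right (by norm_num) (by rw [← hstep]; omega)
          split_ifs
          · exact h2'.trans_le hmono
          · exact h3'.trans_le hmono
        · -- CONSTANT
          rw [K.val_const h1 h2 h3]
          refine (K.cval_lt_two_pow_width g).trans_le (Nat.pow_le_pow_right (by norm_num) ?_)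
          have : K.width g < B := hW
          have := Nat.one_le_two_pow (n := n + 1)
          nlinarith

/-- **The bit budget of a gate**: `valBits g = 2^{H(|g|)} · 2^{dpoly(|g|)}`, a number of polynomially
many bits. [cite: KoiranPerifel2009VPSPACE, §3.2, Prop. 1 (proof)] -/
def valBits (g : List Bool) : ℕ := 2 ^ K.hdrPoly.eval g.length * 2 ^ K.dpoly.eval g.length

/-- **Every gate value is `< 2^{valBits g}`.** [cite: KoiranPerifel2009VPSPACE, §3.2, Prop. 1 (proof)] -/
theorem val_lt_two_pow_valBits (g : List Bool) : K.val g < 2 ^ K.valBits g :=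
  (K.val_lt_two_pow_hdrPoly (K.dpoly.eval g.length) g (K.depth_le g)).trans_le le_rfl

/-- All bits of a gate value from `valBits g` on vanish. [cite: KoiranPerifel2009VPSPACE, §3.2, Prop. 1 (proof)] -/
theorem testBit_val_eq_false {g : List Bool} {i : ℕ} (hi : K.valBits g ≤ i) : (K.val g).testBit i = false :=
  Nat.testBit_lt_two_pow ((K.val_lt_two_pow_valBits g).trans_le (Nat.pow_le_pow_right (by norm_num) hi))

/-- `valBits` is computed on names in polynomial time (a product of two powers of two with unary
exponents). [cite: AroraBarak2009, §1.3] -/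
theorem valBits_fp : CodeFP strE natE K.valBits := by
  have hH : CodeFP strE unE (fun g => K.hdrPoly.eval g.length) :=
    of_fn (Plumb.polyFn K.hdrPoly) (Plumb.polyFn_mem_FP _) fun g => by
      rw [Plumb.polyFn_apply, unE_eq_ones]; rfl
  have hD : CodeFP strE unE (fun g => K.dpoly.eval g.length) :=
    of_fn (Plumb.polyFn K.dpoly) (Plumb.polyFn_mem_FP _) fun g => by
      rw [Plumb.polyFn_apply, unE_eq_ones]; rfl
  have h1 : CodeFP strE natE (fun g => 2 ^ K.hdrPoly.eval g.length) := natPow.comp ((const strE (2 : ℕ)).pair hH)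
  have h2 : CodeFP strE natE (fun g => 2 ^ K.dpoly.eval g.length) := natPow.comp ((const strE (2 : ℕ)).pair hD)
  exact (natMul.comp (h1.pair h2)).congr fun g => rfl

/-! ### Two's complement: integers carried by natural representatives modulo `2^{v+1}` -/

section TwosComplement

/-- The two's-complement representative of an integer `c` on `v + 1` bits: `c mod 2^{v+1}` as a
natural number. [cite: KnuthTAOCP2, §4.1 (two's complement notation)] -/
def twosRep (v : ℕ) (c : ℤ) : ℕ := (c % 2 ^ (v + 1)).toNat

/-- The representative represents: `twosRep v c ≡ c (mod 2^{v+1})`. [cite: KnuthTAOCP2, §4.1] -/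
theorem twosRep_modEq (v : ℕ) (c : ℤ) : (twosRep v c : ℤ) ≡ c [ZMOD 2 ^ (v + 1)] := by
  rw [twosRep, Int.toNat_of_nonneg (Int.emod_nonneg _ (by positivity))]
  exact Int.mod_modEq _ _

/-- The representative has `≤ v + 1` bits. [cite: KnuthTAOCP2, §4.1] -/
theorem twosRep_lt (v : ℕ) (c : ℤ) : twosRep v c < 2 ^ (v + 1) := by
  have h := Int.emod_lt_of_pos c (show (0 : ℤ) < 2 ^ (v + 1) by positivity)
  have h0 := Int.emod_nonneg c (show (2 : ℤ) ^ (v + 1) ≠ 0 by positivity)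
  rw [twosRep]
  zify
  rw [Int.toNat_of_nonneg h0]
  exact_mod_cast h

/-- The residue of a representative: if `X ≡ c (mod 2^{v+1})` then `X mod 2^{v+1} = twosRep v c`. [cite: KnuthTAOCP2, §4.1] -/
theorem mod_eq_twosRep {v : ℕ} {c : ℤ} {X : ℕ} (hX : (X : ℤ) ≡ c [ZMOD 2 ^ (v + 1)]) :
    X % 2 ^ (v + 1) = twosRep v c := by
  have h0 := Int.emod_nonneg c (show (2 : ℤ) ^ (v + 1) ≠ 0 by positivity)
  rw [twosRep]
  zify
  rw [Int.toNat_of_nonneg h0]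
  exact_mod_cast hX

/-- The representative of a nonnegative small integer is the integer itself. [cite: KnuthTAOCP2, §4.1] -/
theorem twosRep_of_nonneg {v : ℕ} {c : ℤ} (h0 : 0 ≤ c) (hc : c < 2 ^ v) : twosRep v c = c.natAbs := by
  have hlt : c < 2 ^ (v + 1) := hc.trans (by exact_mod_cast Nat.pow_lt_pow_right (by norm_num) (Nat.lt_succ_self v))
  rw [twosRep, Int.emod_eq_of_lt h0 hlt]
  zify
  rw [Int.toNat_of_nonneg h0, abs_of_nonneg h0]

/-- The representative of a negative small integer is `2^{v+1} − |c|`. [cite: KnuthTAOCP2, §4.1 ("−x is represented by 2ⁿ − x")] -/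
theorem twosRep_of_neg {v : ℕ} {c : ℤ} (h0 : c < 0) (hc : -(2 : ℤ) ^ v ≤ c) : twosRep v c = 2 ^ (v + 1) - c.natAbs := by
  have h2v : (2 : ℤ) ^ (v + 1) = 2 * 2 ^ v := by ring
  have habs : (c.natAbs : ℤ) = -c := by rw [Int.natCast_natAbs, abs_of_neg h0]
  have hle : c.natAbs ≤ 2 ^ (v + 1) := by
    have : (c.natAbs : ℤ) ≤ 2 ^ (v + 1) := by rw [habs, h2v]; linarith
    exact_mod_cast this
  have hmod : c % 2 ^ (v + 1) = c + 2 ^ (v + 1) := by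
    rw [← Int.add_mul_emod_self_left c (2 ^ (v + 1)) 1, mul_one]
    exact Int.emod_eq_of_lt (by rw [h2v]; linarith) (by linarith)
  rw [twosRep, hmod]
  have hnn : (0 : ℤ) ≤ c + 2 ^ (v + 1) := by rw [h2v]; linarith
  zify [hle]
  rw [Int.toNat_of_nonneg hnn, abs_of_neg h0]
  ring

/-- **Sign read-out**: for `|c| < 2^v` and any representative `X ≡ c (mod 2^{v+1})`, `c < 0` iff bit
`v` of `X` is set. [cite: KnuthTAOCP2, §4.1 (the sign is the leading bit)] [cite: KoiranPerifel2009VPSPACE, §3.1, Def. 1 ("a(n, α, 0) is the sign")] -/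
theorem neg_iff_testBit {v : ℕ} {c : ℤ} (hc : c.natAbs < 2 ^ v) {X : ℕ} (hX : (X : ℤ) ≡ c [ZMOD 2 ^ (v + 1)]) :
    c < 0 ↔ X.testBit v = true := by
  have hres := mod_eq_twosRep hX
  -- bit `v` of `X` is bit `v` of its residue
  have hbit : X.testBit v = (X % 2 ^ (v + 1)).testBit v := by
    rw [Nat.testBit_mod_two_pow]; simp
  rw [hbit, hres, Nat.testBit_eq_decide_div_mod_eq]
  by_cases h0 : c < 0
  · have hc' : -(2 : ℤ) ^ v ≤ c := by
      have : (c.natAbs : ℤ) = -c := by rw [Int.natCast_natAbs, abs_of_neg h0]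
      have : (c.natAbs : ℤ) < 2 ^ v := by exact_mod_cast hc
      linarith
    rw [twosRep_of_neg h0 hc']
    simp only [h0, true_iff, decide_eq_true_eq]
    have h1 : 2 ^ (v + 1) - c.natAbs = 2 ^ v + (2 ^ v - c.natAbs) := by rw [pow_succ]; omega
    have h2 : (2 ^ v - c.natAbs) < 2 ^ v := by
      have : 0 < c.natAbs := Int.natAbs_pos.2 h0.ne; omega
    rw [h1, Nat.add_div_of_dvd_right (dvd_refl _), Nat.div_self (by positivity), Nat.div_eq_of_lt h2]
  · have h0' : 0 ≤ c := le_of_not_gt h0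
    have hcv : c < 2 ^ v := by
      have : (c.natAbs : ℤ) = c := by rw [Int.natCast_natAbs, abs_of_nonneg h0']
      have : (c.natAbs : ℤ) < 2 ^ v := by exact_mod_cast hc
      linarith
    rw [twosRep_of_nonneg h0' hcv, Nat.div_eq_of_lt hc]
    simp [h0]

/-- **Magnitude read-out (nonnegative case)**: for `0 ≤ c < 2^v` and a representative `X`, the bits
of `|c|` below `v + 1` are the bits of `X` (for `c < 0` apply this to `−c` and a representative of
`−c`, `neg_rep`). [cite: KnuthTAOCP2, §4.1] [cite: KoiranPerifel2009VPSPACE, §3.1, Def. 1] -/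
theorem testBit_natAbs_of_nonneg {v : ℕ} {c : ℤ} (h0 : 0 ≤ c) (hc : c.natAbs < 2 ^ v) {X : ℕ}
    (hX : (X : ℤ) ≡ c [ZMOD 2 ^ (v + 1)]) {j : ℕ} (hj : j ≤ v) : c.natAbs.testBit j = X.testBit j := by
  have hcv : c < 2 ^ v := by
    have : (c.natAbs : ℤ) = c := by rw [Int.natCast_natAbs, abs_of_nonneg h0]
    have : (c.natAbs : ℤ) < 2 ^ v := by exact_mod_cast hc
    linarith
  have hres := mod_eq_twosRep hX
  rw [twosRep_of_nonneg h0 hcv] at hres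
  have : X.testBit j = (X % 2 ^ (v + 1)).testBit j := by
    rw [Nat.testBit_mod_two_pow]; simp [show j < v + 1 by omega]
  rw [this, hres]

/-- Bits of `|c|` from `v` on vanish (so the read-out above covers all of them). [cite: KnuthTAOCP2, §4.1] -/
theorem testBit_natAbs_eq_false {v : ℕ} {c : ℤ} (hc : c.natAbs < 2 ^ v) {j : ℕ} (hj : v ≤ j) :
    c.natAbs.testBit j = false :=
  Nat.testBit_lt_two_pow (hc.trans_le (Nat.pow_le_pow_right (by norm_num) hj))

/-- **Zero test**: for `|c| < 2^v` and a representative `X`, `c = 0` iff `X ≡ 0 (mod 2^{v+1})` — the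
test a select gate of width `v + 1` performs against a zero constant. [cite: KnuthTAOCP2, §4.1] -/
theorem eq_zero_iff_mod {v : ℕ} {c : ℤ} (hc : c.natAbs < 2 ^ v) {X : ℕ} (hX : (X : ℤ) ≡ c [ZMOD 2 ^ (v + 1)]) :
    c = 0 ↔ X % 2 ^ (v + 1) = 0 := by
  rw [mod_eq_twosRep hX]
  have hv : (2 : ℤ) ^ v < 2 ^ (v + 1) := by exact_mod_cast Nat.pow_lt_pow_right (by norm_num) (Nat.lt_succ_self v)
  have habs : (c.natAbs : ℤ) < 2 ^ v := by exact_mod_cast hc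
  constructor
  · rintro rfl
    simp [twosRep]
  · intro h
    by_cases h0 : c < 0
    · have hcabs : (c.natAbs : ℤ) = -c := by rw [Int.natCast_natAbs, abs_of_neg h0]
      rw [twosRep_of_neg h0 (by linarith)] at h
      have : c.natAbs < 2 ^ (v + 1) := by
        have : (c.natAbs : ℤ) < 2 ^ (v + 1) := by linarith
        exact_mod_cast this
      have : 0 < c.natAbs := Int.natAbs_pos.2 h0.ne
      omega
    · have h0' : 0 ≤ c := le_of_not_gt h0
      have hcabs : (c.natAbs : ℤ) = c := by rw [Int.natCast_natAbs, abs_of_nonneg h0']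
      rw [twosRep_of_nonneg h0' (by linarith)] at h
      exact Int.natAbs_eq_zero.1 h

/-- Representatives are stable under sums. [cite: KnuthTAOCP2, §4.1] -/
theorem add_rep {v : ℕ} {c d : ℤ} {X Y : ℕ} (hX : (X : ℤ) ≡ c [ZMOD 2 ^ (v + 1)])
    (hY : (Y : ℤ) ≡ d [ZMOD 2 ^ (v + 1)]) : ((X + Y : ℕ) : ℤ) ≡ c + d [ZMOD 2 ^ (v + 1)] := by
  push_cast; exact hX.add hY

/-- Representatives are stable under products. [cite: KnuthTAOCP2, §4.1] -/
theorem mul_rep {v : ℕ} {c d : ℤ} {X Y : ℕ} (hX : (X : ℤ) ≡ c [ZMOD 2 ^ (v + 1)])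
    (hY : (Y : ℤ) ≡ d [ZMOD 2 ^ (v + 1)]) : ((X * Y : ℕ) : ℤ) ≡ c * d [ZMOD 2 ^ (v + 1)] := by
  push_cast; exact hX.mul hY

/-- Representatives are stable under finite sums. [cite: KnuthTAOCP2, §4.1] -/
theorem sum_rep {v : ℕ} (A : ℕ) {c : ℕ → ℤ} {X : ℕ → ℕ} (h : ∀ k, k < A → (X k : ℤ) ≡ c k [ZMOD 2 ^ (v + 1)]) :
    ((∑ k ∈ range A, X k : ℕ) : ℤ) ≡ ∑ k ∈ range A, c k [ZMOD 2 ^ (v + 1)] := by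
  induction A with
  | zero => simp [Int.ModEq.refl]
  | succ A ih =>
    rw [sum_range_succ, sum_range_succ]
    push_cast
    have ih' := ih fun k hk => h k (by omega)
    push_cast at ih'
    exact ih'.add (h A (by omega))

/-- **Negation inside the circuit**: `(2^{v+1} − 1) · X` represents `−c` (multiplication by the
all-ones constant). [cite: KnuthTAOCP2, §4.1 (complement arithmetic)] -/
theorem neg_rep {v : ℕ} {c : ℤ} {X : ℕ} (hX : (X : ℤ) ≡ c [ZMOD 2 ^ (v + 1)]) :
    (((2 ^ (v + 1) - 1) * X : ℕ) : ℤ) ≡ -c [ZMOD 2 ^ (v + 1)] := by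
  have h1 : (((2 ^ (v + 1) - 1 : ℕ) : ℤ)) ≡ -1 [ZMOD 2 ^ (v + 1)] := by
    have : ((2 ^ (v + 1) - 1 : ℕ) : ℤ) = 2 ^ (v + 1) - 1 := by
      have := Nat.one_le_two_pow (n := v + 1); push_cast [Nat.cast_sub this]; ring
    rw [this]
    exact (Int.modEq_iff_dvd.2 ⟨-1, by ring⟩)
  have := h1.mul hX
  push_cast at this ⊢
  simpa using this

/-- **The constant's bits in two's complement** (negative case): for `0 < m ≤ 2^v`, bit `i < v + 1` of
the representative `2^{v+1} − m` of `−m` is the complement of bit `i` of `m − 1` ("complement and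
add one"). [cite: KnuthTAOCP2, §4.1] -/
theorem testBit_twosRep_neg {v m i : ℕ} (hm : 0 < m) (hmv : m ≤ 2 ^ v) (hi : i < v + 1) :
    (2 ^ (v + 1) - m).testBit i = !((m - 1).testBit i) := by
  have hlt : m - 1 < 2 ^ (v + 1) := by
    have := Nat.pow_lt_pow_right (show 1 < 2 by norm_num) (Nat.lt_succ_self v); omega
  have h := Nat.testBit_two_pow_sub_succ hlt i
  rw [show m - 1 + 1 = m by omega] at h
  rw [h]
  simp [hi]

end TwosComplement

end SuccCircuit

end Literature.Computability.Complexity
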